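import Literature.Computability.Cryptography.LWESelfTestSamplerLaw
import Literature.Computability.Cryptography.LWEPsiBarSamplerProg
import Literature.Computability.Cryptography.LWESwitchRowProgLaw
import Literature.Computability.Cryptography.LWERateGuessTest
import HarnessLib

/-!
# Self-generated LWE samples as a typed polynomial-time program, and their law on uniform coins

Topic `Computability/Cryptography` (LWE), grouping namespace `BLPRS2013.KProg`; sequel of `LWESelfTestSamplerLaw.lean` (`machSelfLWE`: the law of the machine's
self-generated tuples — secret and `a`'s from residues, noise from `psiLaw`), `LWEPsiBarSamplerProg.lean` (`psiFlat`/`psiOf`: the `Ψ̄` sampler program) and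
`LWESwitchRowProgLaw.lean` (`tFlat`, `shiftOfCoins`, `uniformVector_map_shift`: residues of coin words). This file writes the tuples as a deterministic function
of a flat coin string, in closed form and as a program against a record, proves the program typed polynomial time, and identifies its law on uniform coins
with `machSelfLWE` read through `LWE.MP12.Prog.toItem` (everything PROVED; definitions with bodies; no named fact):

* `dotMod Q a s e = (⟨a, s⟩ + e) mod Q` (on residues), `dotMod_encT`, `selfSampleFlat`, **`selfLWEFlat Q L n m κ̂ b PG coins`** (secret from the first `nL` coins,
  then sample `i` from the `i`-th chunk of width `W = nL + coinLen`: `a` from `nL` coins, `e` by `psiFlat`);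
* `SRec`/`sRecOf`, `wordsOf`, `selfOf` (the program), `selfOf_sRecOf`, `wordsOf_codeFP`, `dotMod_codeFP`, **`selfOf_codeFP`**;
* **`uniformVector_map_selfLWEFlat`** — `(U {0,1}^C).map selfLWEFlat = (machSelfLWE Q n L m κ̂ b PG.lawPMF).map (items)` for `nL + m·W ≤ C`.

## References

* O. Regev, *On lattices, learning with errors …*, J. ACM 56 (2009), Lemma 4.1 (proof: self-generated samples). [RegevLWE2009]
* Z. Brakerski, A. Langlois, C. Peikert, O. Regev, D. Stehlé, *Classical hardness of learning with errors*, STOC 2013; arXiv:1306.0281, Thm. 4.1 (proof) and §5.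
  [BrakerskiEtAl2013]
* S. Arora, B. Barak, *Computational Complexity: A Modern Approach*, CUP 2009, §1.3, Def. 7.1. [AroraBarak2009]
-/

noncomputable section

open scoped ENNReal
open PMF Literature.Probability.Distributions Literature.Algebra.EuclideanLattices

namespace Literature.Computability.Cryptography

namespace BLPRS2013

namespace KProg

open Literature.Computability.Complexity Literature.Computability.Complexity.CodeFP Literature.Computability.QuantumComplexity
  GaussRejMachine LWE LWE.MP12 LWE.MP12.Prog
open Literature.Algebra.EuclideanLattices (encodeRat encodeRat_injective)

/-! ### Closed forms -/

/-- `(⟨a, s⟩ + e) mod Q` on residue lists (integer arithmetic, as the program does it). [cite: RegevLWE2009, Lemma 4.1 (proof)] -/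
def dotMod (Q : ℕ) (a s : List ℕ) (e : ℕ) : ℕ :=
  (((List.zipWith (fun x y : ℕ => ((x * y : ℕ) : ℤ)) a s).sum + (e : ℤ)) % (Q : ℤ)).toNat

/-- **One self-generated sample from a chunk**: `a` from the first `nL` coins, `e` by the `Ψ̄` sampler on the rest, `b = (⟨a, s⟩ + e) mod Q`.
[cite: RegevLWE2009, Lemma 4.1 (proof); BrakerskiEtAl2013, §5] -/
def selfSampleFlat (Q L n : ℕ) (κh : ℚ) (b : ℕ) (PG : PGParams) (s : List ℕ) (ci : List Bool) : List ℕ × ℕ :=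
  let a := tFlat Q L n ci
  (a, dotMod Q a s (psiFlat Q κh b PG (ci.drop (n * L))))

/-- **The self-generated tuple from coins**: the secret from the first `nL` coins, then `m` samples from chunks of width `W = nL + coinLen`.
[cite: RegevLWE2009, Lemma 4.1 (proof); BrakerskiEtAl2013, §5] -/
def selfLWEFlat (Q L n m : ℕ) (κh : ℚ) (b : ℕ) (PG : PGParams) (coins : List Bool) : List (List ℕ × ℕ) :=
  let s := tFlat Q L n coins
  let rest := coins.drop (n * L)
  let W := n * L + PG.coinLen
  ((List.range m).map fun i => (rest.drop (i * W)).take W).map (selfSampleFlat Q L n κh b PG s)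

/-! ### Record and program -/

/-- **The self-test record**: the `Ψ̄` sampler's record `((Q, (κ̂, b)), (ctx, coinLen))` with `(L, n, m)` (unary). [folklore] -/
abbrev SRec : Type := PRec × (ℕ × ℕ × ℕ)

/-- Its code. [folklore] -/
abbrev sRecE : SRec → List Bool := pairE pRecE (pairE unE (pairE unE unE))

/-- The genuine record. [folklore] -/
def sRecOf (Q : ℕ) (κh : ℚ) (b : ℕ) (PG : PGParams) (L n m : ℕ) : SRec := (pRecOf Q κh b PG, (L, n, m))

/-- `n` residues mod `Q` of `L`-bit words (the program form of `tFlat`). [cite: RegevLWE2009, Lemma 4.1 (proof)] -/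
def wordsOf (Q L n : ℕ) (coins : List Bool) : List ℕ :=
  ((List.range n).map fun j => (coins.drop (j * L)).take L).map fun ch => bitsToNat ch % Q

/-- `wordsOf = tFlat`. [folklore] -/
theorem wordsOf_eq_tFlat (Q L n : ℕ) (coins : List Bool) : wordsOf Q L n coins = tFlat Q L n coins := by
  simp [wordsOf, tFlat, List.map_map, Function.comp_def]

/-- One sample against the record and the secret. [folklore] -/
def selfSampleOf (r : SRec) (s : List ℕ) (ci : List Bool) : List ℕ × ℕ :=
  let a := wordsOf r.1.1.1 r.2.1 r.2.2.1 ci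
  (a, dotMod r.1.1.1 a s (psiOf r.1 (ci.drop (min (r.2.2.1 * r.2.1) ci.length))))

/-- **The self-generated tuple against the record.** [cite: BrakerskiEtAl2013, §5] -/
def selfOf (r : SRec) (coins : List Bool) : List (List ℕ × ℕ) :=
  let s := wordsOf r.1.1.1 r.2.1 r.2.2.1 coins
  let rest := coins.drop (min (r.2.2.1 * r.2.1) coins.length)
  let W := r.2.2.1 * r.2.1 + r.1.2.2
  ((List.range r.2.2.2).map fun i => (rest.drop (i * W)).take W).map (selfSampleOf r s)

/-- At the genuine record the program is the closed form. [folklore] -/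
theorem selfOf_sRecOf (Q : ℕ) (κh : ℚ) (b : ℕ) (PG : PGParams) (L n m : ℕ) (coins : List Bool) :
    selfOf (sRecOf Q κh b PG L n m) coins = selfLWEFlat Q L n m κh b PG coins := by
  have h1 : ∀ (sl : List ℕ) (ci : List Bool), selfSampleOf (sRecOf Q κh b PG L n m) sl ci = selfSampleFlat Q L n κh b PG sl ci := by
    intro sl ci
    simp only [selfSampleOf, selfSampleFlat, sRecOf, pRecOf, wordsOf_eq_tFlat, drop_min_length]
    rw [show psiOf ((Q, κh, b), PG.ctx, PG.coinLen) = psiOf (pRecOf Q κh b PG) from rfl, funext_iff.1 (funext (psiOf_pRecOf Q κh b PG))]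
  unfold selfOf selfLWEFlat
  simp only [show (sRecOf Q κh b PG L n m).2.2.1 = n from rfl, show (sRecOf Q κh b PG L n m).2.1 = L from rfl,
    show (sRecOf Q κh b PG L n m).2.2.2 = m from rfl, show (sRecOf Q κh b PG L n m).1.1.1 = Q from rfl,
    show (sRecOf Q κh b PG L n m).1.2.2 = PG.coinLen from rfl, drop_min_length, wordsOf_eq_tFlat]
  exact List.map_congr_left fun ci _ => h1 _ ci

/-! ### Typed polynomial time -/

section CodeFP

/-- The words-to-residues map is typed polynomial time in `((Q, (L, n)), coins)`. [cite: AroraBarak2009, §1.3] -/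
theorem wordsOf_codeFP : CodeFP (pairE (pairE natE (pairE unE unE)) strE) (rawE natE) (fun p => wordsOf p.1.1 p.1.2.1 p.1.2.2 p.2) := by
  have hQ : CodeFP (pairE (pairE natE (pairE unE unE)) strE) natE (fun p => p.1.1) := (fst _ _).fst'
  have hL : CodeFP (pairE (pairE natE (pairE unE unE)) strE) unE (fun p => p.1.2.1) := (fst _ _).snd'.fst'
  have hn : CodeFP (pairE (pairE natE (pairE unE unE)) strE) unE (fun p => p.1.2.2) := (fst _ _).snd'.snd'
  have hc : CodeFP (pairE (pairE natE (pairE unE unE)) strE) strE (fun p => p.2) := snd _ _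
  have hchunks : CodeFP (pairE (pairE natE (pairE unE unE)) strE) (rawE strE) (fun p => (List.range p.1.2.2).map fun j => (p.2.drop (j * p.1.2.1)).take p.1.2.1) :=
    (strChunks.comp (hn.pair (hL.pair hc)) :)
  have hstep : CodeFP (pairE (pairE (pairE natE (pairE unE unE)) strE) strE) natE (fun t => bitsToNat t.2 % t.1.1.1) :=
    (natMod.comp ((strVal.comp (snd _ _)).pair (fst _ _).fst'.fst') :)
  exact (((map hstep).comp ((CodeFP.id _).pair hchunks)).congr fun p => rfl)

/-- `dotMod` is typed polynomial time in `(Q, (a, (s, e)))`. [cite: AroraBarak2009, §1.3] -/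
theorem dotMod_codeFP : CodeFP (pairE natE (pairE (rawE natE) (pairE (rawE natE) natE))) natE (fun p => dotMod p.1 p.2.1 p.2.2.1 p.2.2.2) := by
  have hQ : CodeFP (pairE natE (pairE (rawE natE) (pairE (rawE natE) natE))) intE (fun p => (p.1 : ℤ)) := (intOfNat.comp (fst _ _) :)
  have ha : CodeFP (pairE natE (pairE (rawE natE) (pairE (rawE natE) natE))) (rawE natE) (fun p => p.2.1) := (snd _ _).fst'
  have hs : CodeFP (pairE natE (pairE (rawE natE) (pairE (rawE natE) natE))) (rawE natE) (fun p => p.2.2.1) := (snd _ _).snd'.fst'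
  have he : CodeFP (pairE natE (pairE (rawE natE) (pairE (rawE natE) natE))) intE (fun p => (p.2.2.2 : ℤ)) := (intOfNat.comp (snd _ _).snd'.snd' :)
  have hprodStep : CodeFP (pairE (pairE natE (pairE (rawE natE) (pairE (rawE natE) natE))) (pairE natE natE)) intE (fun t => ((t.2.1 * t.2.2 : ℕ) : ℤ)) :=
    (intOfNat.comp (natMul.comp ((snd _ _).fst'.pair (snd _ _).snd')) :)
  have hdot : CodeFP (pairE natE (pairE (rawE natE) (pairE (rawE natE) natE))) intE
      (fun p => (List.zipWith (fun x y : ℕ => ((x * y : ℕ) : ℤ)) p.2.1 p.2.2.1).sum) :=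
    (intSum.comp ((zipWith hprodStep).comp ((CodeFP.id _).pair (ha.pair hs))) :)
  have hsum : CodeFP (pairE natE (pairE (rawE natE) (pairE (rawE natE) natE))) intE
      (fun p => (List.zipWith (fun x y : ℕ => ((x * y : ℕ) : ℤ)) p.2.1 p.2.2.1).sum + (p.2.2.2 : ℤ)) := (intAdd.comp (hdot.pair he) :)
  have hmod : CodeFP (pairE natE (pairE (rawE natE) (pairE (rawE natE) natE))) intE
      (fun p => ((List.zipWith (fun x y : ℕ => ((x * y : ℕ) : ℤ)) p.2.1 p.2.2.1).sum + (p.2.2.2 : ℤ)) % (p.1 : ℤ)) :=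
    ((intSub.comp (hsum.pair (intMul.comp (hQ.pair (intEDiv.comp (hsum.pair hQ)))))).congr fun p => by rw [Int.emod_def])
  exact ((intToNat.comp hmod).congr fun p => rfl)

/-- One sample against `((record, secret), chunk)` is typed polynomial time. [cite: AroraBarak2009, §1.3] -/
theorem selfSampleOf_codeFP : CodeFP (pairE (pairE sRecE (rawE natE)) strE) (pairE (rawE natE) natE) (fun t => selfSampleOf t.1.1 t.1.2 t.2) := by
  have hr : CodeFP (pairE (pairE sRecE (rawE natE)) strE) sRecE (fun t => t.1.1) := (fst _ _).fst'
  have hs : CodeFP (pairE (pairE sRecE (rawE natE)) strE) (rawE natE) (fun t => t.1.2) := (fst _ _).snd'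
  have hci : CodeFP (pairE (pairE sRecE (rawE natE)) strE) strE (fun t => t.2) := snd _ _
  have hQ : CodeFP (pairE (pairE sRecE (rawE natE)) strE) natE (fun t => t.1.1.1.1.1) := hr.fst'.fst'.fst'
  have hL : CodeFP (pairE (pairE sRecE (rawE natE)) strE) unE (fun t => t.1.1.2.1) := hr.snd'.fst'
  have hn : CodeFP (pairE (pairE sRecE (rawE natE)) strE) unE (fun t => t.1.1.2.2.1) := hr.snd'.snd'.fst'
  have ha : CodeFP (pairE (pairE sRecE (rawE natE)) strE) (rawE natE) (fun t => wordsOf t.1.1.1.1.1 t.1.1.2.1 t.1.1.2.2.1 t.2) :=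
    (wordsOf_codeFP.comp ((hQ.pair (hL.pair hn)).pair hci) :)
  have hoff : CodeFP (pairE (pairE sRecE (rawE natE)) strE) unE (fun t => min (t.1.1.2.2.1 * t.1.1.2.1) t.2.length) :=
    (unOfNatMin.comp ((strLength.comp hci).pair (natMul.comp ((natOfUn.comp hn).pair (natOfUn.comp hL)))) :)
  have he : CodeFP (pairE (pairE sRecE (rawE natE)) strE) natE (fun t => psiOf t.1.1.1 (t.2.drop (min (t.1.1.2.2.1 * t.1.1.2.1) t.2.length))) :=
    (psiOf_codeFP.comp (hr.fst'.pair (strDrop.comp (hoff.pair hci))) :)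
  have hb : CodeFP (pairE (pairE sRecE (rawE natE)) strE) natE (fun t => dotMod t.1.1.1.1.1 (wordsOf t.1.1.1.1.1 t.1.1.2.1 t.1.1.2.2.1 t.2) t.1.2
      (psiOf t.1.1.1 (t.2.drop (min (t.1.1.2.2.1 * t.1.1.2.1) t.2.length)))) :=
    (dotMod_codeFP.comp (hQ.pair (ha.pair (hs.pair he))) :)
  exact ((ha.pair hb).congr fun t => rfl)

/-- **The self-generated tuple is typed polynomial time** in `(record, coins)`. [cite: BrakerskiEtAl2013, §5; AroraBarak2009, §1.3] -/
theorem selfOf_codeFP : CodeFP (pairE sRecE strE) (rawE (pairE (rawE natE) natE)) (fun p => selfOf p.1 p.2) := by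
  have hr : CodeFP (pairE sRecE strE) sRecE (fun p => p.1) := fst _ _
  have hc : CodeFP (pairE sRecE strE) strE (fun p => p.2) := snd _ _
  have hQ : CodeFP (pairE sRecE strE) natE (fun p => p.1.1.1.1) := hr.fst'.fst'.fst'
  have hlen : CodeFP (pairE sRecE strE) unE (fun p => p.1.1.2.2) := hr.fst'.snd'.snd'
  have hL : CodeFP (pairE sRecE strE) unE (fun p => p.1.2.1) := hr.snd'.fst'
  have hn : CodeFP (pairE sRecE strE) unE (fun p => p.1.2.2.1) := hr.snd'.snd'.fst'
  have hm : CodeFP (pairE sRecE strE) unE (fun p => p.1.2.2.2) := hr.snd'.snd'.snd'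
  have hs : CodeFP (pairE sRecE strE) (rawE natE) (fun p => wordsOf p.1.1.1.1 p.1.2.1 p.1.2.2.1 p.2) :=
    (wordsOf_codeFP.comp ((hQ.pair (hL.pair hn)).pair hc) :)
  have hoff : CodeFP (pairE sRecE strE) unE (fun p => min (p.1.2.2.1 * p.1.2.1) p.2.length) :=
    (unOfNatMin.comp ((strLength.comp hc).pair (natMul.comp ((natOfUn.comp hn).pair (natOfUn.comp hL)))) :)
  have hrest : CodeFP (pairE sRecE strE) strE (fun p => p.2.drop (min (p.1.2.2.1 * p.1.2.1) p.2.length)) := (strDrop.comp (hoff.pair hc) :)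
  have hW : CodeFP (pairE sRecE strE) unE (fun p => p.1.2.2.1 * p.1.2.1 + p.1.1.2.2) := (unAdd.comp ((unMul_codeFP.comp (hn.pair hL)).pair hlen) :)
  have hchunks : CodeFP (pairE sRecE strE) (rawE strE) (fun p => (List.range p.1.2.2.2).map fun i =>
      ((p.2.drop (min (p.1.2.2.1 * p.1.2.1) p.2.length)).drop (i * (p.1.2.2.1 * p.1.2.1 + p.1.1.2.2))).take (p.1.2.2.1 * p.1.2.1 + p.1.1.2.2)) :=
    (strChunks.comp (hm.pair (hW.pair hrest)) :)
  have hmap := (map selfSampleOf_codeFP).comp ((hr.pair hs).pair hchunks)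
  exact hmap.congr fun p => rfl

end CodeFP

/-! ### The law on uniform coins -/

section Law

variable {Q : ℕ} [NeZero Q] {n : ℕ}

/-- `encT` is injective. [folklore] -/
private theorem encT_injective' : Function.Injective (encT (n := n) (q' := Q)) := by
  intro t₁ t₂ h
  funext j
  have := congrFun (List.ofFn_inj.1 h) j
  exact ZMod.val_injective Q this

/-- `dotMod` on residue encodings is `ZMod.val` of `⟨a, s⟩ + e`. [folklore] -/
theorem dotMod_encT (a s : Fin n → ZMod Q) (e : ZMod Q) : dotMod Q (encT a) (encT s) e.val = (a ⬝ᵥ s + e).val := by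
  unfold dotMod
  rw [toNat_emod_eq_val (q := Q)]
  congr 1
  rw [encT, encT, zipWith_ofFn_ofFn, List.sum_ofFn, dotProduct]
  push_cast
  congr 1
  · refine Finset.sum_congr rfl fun j _ => ?_
    rw [ZMod.natCast_zmod_val, ZMod.natCast_zmod_val]
  · rw [ZMod.natCast_zmod_val]

/-- The `Ψ̄` sampler's residue is below `Q`. [folklore] -/
theorem psiFlat_lt (κh : ℚ) (b : ℕ) (PG : PGParams) (coins : List Bool) : psiFlat Q κh b PG coins < Q := by
  unfold psiFlat
  have hQ : (0 : ℤ) < Q := by exact_mod_cast Nat.pos_of_ne_zero (NeZero.ne Q)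
  have h1 := Int.emod_lt_of_pos (psiValueQ κh b (PG.samplerFlat (coins.take PG.coinLen))) hQ
  have h0 := Int.emod_nonneg (psiValueQ κh b (PG.samplerFlat (coins.take PG.coinLen))) hQ.ne'
  omega

/-- **One self-generated sample is `toItem (a, ⟨a, s⟩ + e)`** with `a` the chunk's residues and `e` the `Ψ̄` sampler's value. [folklore] -/
theorem selfSampleFlat_eq_toItem (L : ℕ) (κh : ℚ) (b : ℕ) (PG : PGParams) (s : Fin n → ZMod Q) {W : ℕ} (h : L * n ≤ W) (ci : List.Vector Bool W) :
    selfSampleFlat Q L n κh b PG (encT s) ci.toList =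
      toItem ((shiftOfCoins Q L n h ci), (shiftOfCoins Q L n h ci) ⬝ᵥ s + ((psiFlat Q κh b PG (ci.toList.drop (n * L)) : ℕ) : ZMod Q)) := by
  unfold selfSampleFlat toItem
  simp only [Prod.mk.injEq]
  rw [tFlat_eq_encT h]
  refine ⟨rfl, ?_⟩
  have hval : psiFlat Q κh b PG (ci.toList.drop (n * L)) = (((psiFlat Q κh b PG (ci.toList.drop (n * L)) : ℕ) : ZMod Q)).val := by
    rw [ZMod.val_natCast, Nat.mod_eq_of_lt (psiFlat_lt κh b PG _)]
  conv_lhs => rw [hval]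
  exact dotMod_encT _ _ _

/-- The shift read off a word depends only on its first `nL` coins. [folklore] -/
theorem shiftOfCoins_eq_take {L W : ℕ} (h : L * n ≤ W) (h1 : n * L ≤ W) (ci : List.Vector Bool W) :
    shiftOfCoins Q L n h ci = shiftOfCoins Q L n (le_of_eq (Nat.mul_comm L n)) (⟨ci.toList.take (n * L), by simp [h1]⟩ : List.Vector Bool (n * L)) := by
  apply encT_injective'
  rw [← tFlat_eq_encT h ci, ← tFlat_eq_encT]
  conv_lhs => rw [← List.take_append_drop (n * L) ci.toList]
  rw [tFlat_append_left _ (by rw [List.length_take, List.Vector.toList_length, min_eq_left h1])]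
  rfl

/-- **The law of one self-generated sample from a uniform chunk** of width `W ≥ nL + coinLen`: `lweSampleWith (residues) (psiLaw) s`, read through `toItem`.
[cite: RegevLWE2009, Lemma 4.1 (proof); AroraBarak2009, Def. 7.1] -/
theorem uniformVector_map_selfSampleFlat (L : ℕ) (κh : ℚ) (b : ℕ) (PG : PGParams) (s : Fin n → ZMod Q) {W : ℕ} (hW : n * L + PG.coinLen ≤ W) :
    (uniformOfFintype (List.Vector Bool W)).map (fun ci => selfSampleFlat Q L n κh b PG (encT s) ci.toList) =
      (lweSampleWith (iidPMF (modLaw (2 ^ L) Q) n) (psiLaw Q (κh : ℝ) b PG.lawPMF) s).map toItem := by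
  classical
  have h1 : n * L ≤ W := le_of_add_le_left hW
  have hLn : L * n ≤ n * L := le_of_eq (Nat.mul_comm L n)
  have hLW : L * n ≤ W := hLn.trans h1
  -- split the chunk at `nL`: `a` from the prefix, `e` from the rest
  have hfac : (fun ci : List.Vector Bool W => selfSampleFlat Q L n κh b PG (encT s) ci.toList) =
      (fun pr : List.Vector Bool (n * L) × List.Vector Bool (W - n * L) =>
        toItem (d := n) (Q := Q) ((shiftOfCoins Q L n hLn pr.1),
          (shiftOfCoins Q L n hLn pr.1) ⬝ᵥ s + ((psiFlat Q κh b PG pr.2.toList : ℕ) : ZMod Q))) ∘ vecSplit (n * L) W h1 := by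
    funext ci
    simp only [Function.comp_apply, vecSplit, Equiv.coe_fn_mk]
    rw [selfSampleFlat_eq_toItem L κh b PG s hLW ci, shiftOfCoins_eq_take hLW h1 ci]
    rfl
  rw [hfac, ← PMF.map_comp, uniformVector_map_vecSplit, uniformOfFintype_prod_eq_bind, PMF.map_bind]
  simp only [PMF.map_comp, Function.comp_def]
  -- the noise from the rest of the chunk
  have he : (uniformOfFintype (List.Vector Bool (W - n * L))).map (fun v => ((psiFlat Q κh b PG v.toList : ℕ) : ZMod Q)) = psiLaw Q (κh : ℝ) b PG.lawPMF := by
    rw [show (fun v : List.Vector Bool (W - n * L) => ((psiFlat Q κh b PG v.toList : ℕ) : ZMod Q)) =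
        (fun k : ℕ => (k : ZMod Q)) ∘ (fun v : List.Vector Bool (W - n * L) => psiFlat Q κh b PG v.toList) from rfl,
      ← PMF.map_comp, uniformVector_map_psiFlat Q κh b PG (by omega), PMF.map_comp]
    conv_rhs => rw [← PMF.map_id (psiLaw Q (κh : ℝ) b PG.lawPMF)]
    congr 1
    funext x
    simp
  calc ((uniformOfFintype (List.Vector Bool (n * L))).bind fun v₁ =>
        (uniformOfFintype (List.Vector Bool (W - n * L))).map fun v₂ =>
          toItem (d := n) (Q := Q) ((shiftOfCoins Q L n hLn v₁), (shiftOfCoins Q L n hLn v₁) ⬝ᵥ s + ((psiFlat Q κh b PG v₂.toList : ℕ) : ZMod Q)))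
      = ((uniformOfFintype (List.Vector Bool (n * L))).map (shiftOfCoins Q L n hLn)).bind fun a =>
          ((uniformOfFintype (List.Vector Bool (W - n * L))).map fun v₂ => ((psiFlat Q κh b PG v₂.toList : ℕ) : ZMod Q)).map
            fun e => toItem (d := n) (Q := Q) (a, a ⬝ᵥ s + e) := by
        rw [PMF.bind_map]
        simp only [PMF.map_comp, Function.comp_def]
    _ = (iidPMF (modLaw (2 ^ L) Q) n).bind fun a => (psiLaw Q (κh : ℝ) b PG.lawPMF).map fun e => toItem (d := n) (Q := Q) (a, a ⬝ᵥ s + e) := by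
        rw [uniformVector_map_shift, he]
    _ = _ := by
        rw [lweSampleWith, PMF.map_bind]
        simp only [PMF.map_comp, Function.comp_def]

/-- **On uniform coins the self-test program samples `machSelfLWE`** (read through `toItem`), for coin strings of length `C ≥ nL + m·(nL + coinLen)`.
[cite: RegevLWE2009, Lemma 4.1 (proof); BrakerskiEtAl2013, §5; AroraBarak2009, Def. 7.1] -/
theorem uniformVector_map_selfLWEFlat (L m : ℕ) (κh : ℚ) (b : ℕ) (PG : PGParams) {C : ℕ} (hC : n * L + m * (n * L + PG.coinLen) ≤ C) :
    (uniformOfFintype (List.Vector Bool C)).map (fun v => selfLWEFlat Q L n m κh b PG v.toList) =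
      (machSelfLWE Q n L m (κh : ℝ) b PG.lawPMF).map fun S => List.ofFn fun i => toItem (S i) := by
  classical
  have h1 : n * L ≤ C := le_of_add_le_left hC
  have hLn : L * n ≤ n * L := le_of_eq (Nat.mul_comm L n)
  have hm : (n * L + PG.coinLen) * m ≤ C - n * L := by rw [Nat.mul_comm]; omega
  -- secret from the first `nL` coins, samples from the rest
  set smp : (Fin n → ZMod Q) → List.Vector Bool (C - n * L) → List (List ℕ × ℕ) := fun s v₂ =>
    List.ofFn fun i : Fin m => selfSampleFlat Q L n κh b PG (encT s) (chunks (n * L + PG.coinLen) m hm v₂ i).toList with hsmp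
  have hfac : (fun v : List.Vector Bool C => selfLWEFlat Q L n m κh b PG v.toList) =
      (fun pr : List.Vector Bool (n * L) × List.Vector Bool (C - n * L) => smp (shiftOfCoins Q L n hLn pr.1) pr.2) ∘ vecSplit (n * L) C h1 := by
    funext v
    simp only [Function.comp_apply, vecSplit, Equiv.coe_fn_mk, hsmp]
    unfold selfLWEFlat
    have ht : tFlat Q L n v.toList = encT (shiftOfCoins Q L n hLn ⟨v.toList.take (n * L), by simp [h1]⟩) := by
      rw [← tFlat_eq_encT]
      conv_lhs => rw [← List.take_append_drop (n * L) v.toList]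
      rw [tFlat_append_left _ (by rw [List.length_take, List.Vector.toList_length, min_eq_left h1])]
      rfl
    simp only [ht, chunkList_eq_ofFn, List.map_ofFn]
    rfl
  rw [hfac, ← PMF.map_comp, uniformVector_map_vecSplit, uniformOfFintype_prod_eq_bind, PMF.map_bind]
  simp only [PMF.map_comp, Function.comp_def]
  -- the law of the samples given the secret
  have hsmpLaw : ∀ s : Fin n → ZMod Q, (uniformOfFintype (List.Vector Bool (C - n * L))).map (smp s) =
      (iidPMF ((lweSampleWith (iidPMF (modLaw (2 ^ L) Q) n) (psiLaw Q (κh : ℝ) b PG.lawPMF) s).map (toItem (d := n) (Q := Q))) m).map List.ofFn := by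
    intro s
    have hf : smp s = List.ofFn ∘ (fun c (i : Fin m) => selfSampleFlat Q L n κh b PG (encT s) (c i).toList) ∘ chunks (n * L + PG.coinLen) m hm := by
      funext v₂; rfl
    rw [hf, ← PMF.map_comp, ← PMF.map_comp, uniformVector_map_chunks_eq_indepLaw,
      indepLaw_map_pi m _ (fun (_ : Fin m) (c : List.Vector Bool (n * L + PG.coinLen)) => selfSampleFlat Q L n κh b PG (encT s) c.toList), ← indepLaw_const]
    congr 2
    funext i
    exact uniformVector_map_selfSampleFlat L κh b PG s le_rfl
  calc ((uniformOfFintype (List.Vector Bool (n * L))).bind fun v₁ => (uniformOfFintype (List.Vector Bool (C - n * L))).map fun v₂ => smp (shiftOfCoins Q L n hLn v₁) v₂)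
      = ((uniformOfFintype (List.Vector Bool (n * L))).map (shiftOfCoins Q L n hLn)).bind fun s =>
          (uniformOfFintype (List.Vector Bool (C - n * L))).map (smp s) := by rw [PMF.bind_map]; rfl
    _ = (iidPMF (modLaw (2 ^ L) Q) n).bind fun s =>
          (iidPMF ((lweSampleWith (iidPMF (modLaw (2 ^ L) Q) n) (psiLaw Q (κh : ℝ) b PG.lawPMF) s).map (toItem (d := n) (Q := Q))) m).map List.ofFn := by
        rw [uniformVector_map_shift]
        congr 1
        funext s
        exact hsmpLaw s
    _ = (machSelfLWE Q n L m (κh : ℝ) b PG.lawPMF).map fun S => List.ofFn fun i => toItem (S i) := by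
        rw [machSelfLWE, lweSelfWith, PMF.map_bind]
        congr 1
        funext s
        rw [lweSamplesWith, show (fun S : Fin m → (Fin n → ZMod Q) × ZMod Q => List.ofFn fun i => toItem (d := n) (Q := Q) (S i)) =
          List.ofFn ∘ (fun S i => toItem (d := n) (Q := Q) (S i)) from rfl, ← PMF.map_comp, iidPMF_map_pi]

end Law

end KProg

end BLPRS2013

end Literature.Computability.Cryptography

end
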